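import Summits.AnomalousDissipation.AnomalousDissipation.Theorems.TwodBoundedEnergyZeroMomentum.Negative.FirstShellRigidity
import Literature.Barriers.AnomalousDissipation.GravestModeLaminarAttractorProofs
import Literature.Analysis.FluidPDE.LerayHopfSpectralMeasurability
import Literature.Analysis.FluidPDE.DoeringFoiasPowerProofs

/-!
# General first-shell forces, I: bookkeeping and decay of the enstrophy excess (Galerkin half)
(negative-side support for the crux `TwoAndHalfD.TwodBoundedEnergyZeroMomentum`,
stmt-AnomalousDissipation-10786; cdisprove seat `refuter-cdisprove-stmt-AnomalousDissipation-10786-g2-0`)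

First of three files (`FirstShellGalerkin` → `FirstShellTrilinear` → `FirstShellGeneral`)
proving that the WHOLE first Stokes eigenspace of `(UnitAddTorus (Fin 2))` is rigid for the crux: under every smooth
divergence-free mean-zero force `g` with Fourier support on the shell `|k|² = 1` (the
4-dimensional space of FMRT 2001, Ch. III §3.1, "`λ₁ = λ₂ = λ₃ = λ₄`", not only the single pair
`marchioroForce α` of generation 1's `FirstShellRigidity`), every zero-momentum global
Leray–Hopf solution has mean energy `≥ ‖g‖₂²/(16π⁴ν²)`, so the crux with the extra first-shell
clause is false and every witness force needs a mode with `|k|² ≥ 2`.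

This file: a first-shell force is its own truncation `P₁g`, a real trigonometric polynomial,
smooth, with `ĝ(0) = 0`, `Δg = -4π²g` and `∫‖g‖² = ∑_{|k|≤1} ‖ĝ(k)‖² > 0` when `g ≠ 0`; and
HALF 1 of the printed proof of Marchioro's theorem (FMRT App. III.A.4 (A.32)–(A.34): a global
Leray–Hopf solution bounded in `L²` with enstrophy excess `→ 0`) for a GENERAL first-shell force —
the tree's `firstMode_exists_lerayHopf_enstrophyExcess_tendsto_zero_holds` verbatim with the force
generalised (its Galerkin algebra `sum_excessWeight_mul_re_inner_galerkinField_le` only uses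
"`(f, Au) = λ₁(f, u)`", i.e. force coefficients supported on `|k|² = 1`).

## References

* C. Foias, O. Manley, R. Rosa, R. Temam, *Navier–Stokes Equations and Turbulence*, CUP 2001,
  Ch. III §3.1; App. II.A (A.42); App. III.A.4 (A.32)–(A.34), pp. 178–180.
* C. Marchioro, Comm. Math. Phys. 105 (1986) 99–106.
-/

noncomputable section

open MeasureTheory Set Filter Topology UnitAddTorus
open scoped ENNReal NNReal InnerProductSpace ComplexConjugate

namespace Summit.AnomalousDissipation.AnomalousDissipation.Theorems.TwodBoundedEnergyZeroMomentum.Negative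

open Literature.Analysis.FunctionSpaces Literature.Analysis.FunctionSpaces.Torus
open Literature.Analysis.FluidPDE Literature.Analysis.FluidPDE.Torus
open Literature.Barriers.AnomalousDissipation


/-! ### First-shell forces: bookkeeping -/

section FirstShellForce

variable {g : (UnitAddTorus (Fin 2)) → (EuclideanSpace ℝ (Fin 2))}

/-- A first-shell force (no Fourier mode with `|k|² ≠ 1`) is band-limited to the ball `|k|² ≤ 1`:
it is its own truncation `P₁ g`. [folklore] -/
theorem fourierTruncate_one_eq_self_of_firstShell (hgc : Continuous g)
    (hg1 : ∀ k : (Fin 2 → ℤ), freqNormSq k ≠ 1 → mFourierCoeff (EuclideanSpace.complexify ∘ g) k = 0) :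
    fourierTruncate 1 g = g := by
  refine fourierTruncate_eq_self hgc fun k hk => hg1 k ?_
  have hk' : (1 : ℝ) < freqNormSq k := by simpa using hk
  exact ne_of_gt hk'

/-- A first-shell force is the real trigonometric polynomial of its own coefficients on the
ball `|k|² ≤ 1`. [folklore] -/
theorem eq_realTrigPoly_of_firstShell (hgc : Continuous g)
    (hg1 : ∀ k : (Fin 2 → ℤ), freqNormSq k ≠ 1 → mFourierCoeff (EuclideanSpace.complexify ∘ g) k = 0) :
    g = realTrigPoly (freqBall 1) (fun k => mFourierCoeff (EuclideanSpace.complexify ∘ g) k) := by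
  conv_lhs => rw [← fourierTruncate_one_eq_self_of_firstShell hgc hg1]
  rfl

/-- A first-shell force is smooth. [folklore] -/
theorem isSmooth_of_firstShell (hgc : Continuous g)
    (hg1 : ∀ k : (Fin 2 → ℤ), freqNormSq k ≠ 1 → mFourierCoeff (EuclideanSpace.complexify ∘ g) k = 0) :
    IsSmooth g := by
  rw [eq_realTrigPoly_of_firstShell hgc hg1]
  exact isSmooth_realTrigPoly _ _

/-- A first-shell force has no mean mode: `ĝ(0) = 0` (`|0|² = 0 ≠ 1`). [folklore] -/
theorem mFourierCoeff_zero_of_firstShell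
    (hg1 : ∀ k : (Fin 2 → ℤ), freqNormSq k ≠ 1 → mFourierCoeff (EuclideanSpace.complexify ∘ g) k = 0) :
    mFourierCoeff (EuclideanSpace.complexify ∘ g) 0 = 0 :=
  hg1 0 (by simp [freqNormSq])

/-- **A first-shell force is a Stokes eigenfunction for `λ₁ = 4π²`**: `Δg = -4π² g` pointwise. [folklore] -/
theorem laplacian_of_firstShell (hgc : Continuous g)
    (hg1 : ∀ k : (Fin 2 → ℤ), freqNormSq k ≠ 1 → mFourierCoeff (EuclideanSpace.complexify ∘ g) k = 0)
    (x : (UnitAddTorus (Fin 2))) : laplacian g x = -(4 * Real.pi ^ 2) • g x := by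
  set c : (Fin 2 → ℤ) → (EuclideanSpace ℂ (Fin 2)) := fun k => mFourierCoeff (EuclideanSpace.complexify ∘ g) k with hc
  have hg : g = realTrigPoly (freqBall 1) c := eq_realTrigPoly_of_firstShell hgc hg1
  have hcoef : ∀ k ∈ freqBall (d := Fin 2) 1,
      -(((4 * Real.pi ^ 2 * freqNormSq k : ℝ) : ℂ) • c k) = ((-(4 * Real.pi ^ 2) : ℝ) : ℂ) • c k := by
    intro k hk
    rcases eq_zero_or_freqNormSq_eq_one_of_mem_freqBall_one hk with rfl | h1
    · have h0 : c 0 = 0 := mFourierCoeff_zero_of_firstShell hg1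
      rw [h0, smul_zero, smul_zero, neg_zero]
    · rw [h1, mul_one, ← neg_smul]
      push_cast
      ring_nf
  rw [hg, laplacian_realTrigPoly, show realTrigPoly (freqBall 1)
      (fun k => -(((4 * Real.pi ^ 2 * freqNormSq k : ℝ) : ℂ) • c k)) =
      realTrigPoly (freqBall 1) (fun k => ((-(4 * Real.pi ^ 2) : ℝ) : ℂ) • c k) from
    realTrigPoly_congr hcoef]
  rw [realTrigPoly_apply, realTrigPoly_apply, show (fun k => ((-(4 * Real.pi ^ 2) : ℝ) : ℂ) • c k) =
      ((-(4 * Real.pi ^ 2) : ℝ) : ℂ) • c from rfl, trigPoly_smul, Complex.coe_smul, Pi.smul_apply, map_smul]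

/-- The energy of a first-shell force is the (finite) Parseval sum over the ball `|k|² ≤ 1`. [folklore] -/
theorem integral_norm_sq_of_firstShell (hgc : Continuous g)
    (hg1 : ∀ k : (Fin 2 → ℤ), freqNormSq k ≠ 1 → mFourierCoeff (EuclideanSpace.complexify ∘ g) k = 0) :
    ∫ x, ‖g x‖ ^ 2 = ∑ k ∈ freqBall 1, ‖mFourierCoeff (EuclideanSpace.complexify ∘ g) k‖ ^ 2 := by
  refine integral_norm_sq_eq_sum_of_band_limited hgc fun k hk => hg1 k ?_
  have hk' : (1 : ℝ) < freqNormSq k := by simpa using hk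
  exact ne_of_gt hk'

/-- A non-zero first-shell force has positive energy `∫ ‖g‖² > 0`. [folklore] -/
theorem integral_norm_sq_pos_of_firstShell (hgc : Continuous g)
    (hg1 : ∀ k : (Fin 2 → ℤ), freqNormSq k ≠ 1 → mFourierCoeff (EuclideanSpace.complexify ∘ g) k = 0)
    (hg0 : g ≠ 0) : 0 < ∫ x, ‖g x‖ ^ 2 := by
  rw [integral_norm_sq_of_firstShell hgc hg1]
  by_contra h
  push Not at h
  have hle : ∑ k ∈ freqBall 1, ‖mFourierCoeff (EuclideanSpace.complexify ∘ g) k‖ ^ 2 ≤ 0 := h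
  have hall : ∀ k ∈ freqBall (d := Fin 2) 1, ‖mFourierCoeff (EuclideanSpace.complexify ∘ g) k‖ ^ 2 = 0 :=
    (Finset.sum_eq_zero_iff_of_nonneg fun k _ => sq_nonneg _).1
      (le_antisymm hle (Finset.sum_nonneg fun k _ => sq_nonneg _))
  apply hg0
  rw [eq_realTrigPoly_of_firstShell hgc hg1]
  have hzero : ∀ k ∈ freqBall (d := Fin 2) 1, mFourierCoeff (EuclideanSpace.complexify ∘ g) k = (0 : (Fin 2 → ℤ) → (EuclideanSpace ℂ (Fin 2))) k := by
    intro k hk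
    have := hall k hk
    rw [sq_eq_zero_iff, norm_eq_zero] at this
    simpa using this
  rw [realTrigPoly_congr hzero, realTrigPoly_zero]

end FirstShellForce

/-! ### Half 1 of Marchioro's argument for a GENERAL first-shell force (Galerkin level, FMRT App. III.A.4 (A.32)–(A.34)) -/

section GalerkinHalf

/-- **Decay of the enstrophy excess under a general first-shell force** (FMRT 2001,
App. III.A.4 (A.32)–(A.34) with App. II.A (A.42), existence form; the tree's
`firstMode_exists_lerayHopf_enstrophyExcess_tendsto_zero_holds` verbatim with the single-pair
force `marchioroForce α` replaced by an arbitrary smooth mean-zero force whose Fourier support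
lies on the first shell `|k|² = 1` — the printed argument uses of the force only
`(f, Au) = λ₁(f,u)`). For every such `g`, `ν > 0` and mean-zero divergence-free datum
`u₀ ∈ L²((UnitAddTorus (Fin 2)))` there is a global Leray–Hopf solution bounded in `L²` uniformly in time whose
enstrophy excess tends to zero. [cite: FoiasManleyRosaTemam2001, App. III.A.4 (A.32)–(A.34)] -/
theorem exists_lerayHopf_enstrophyExcess_tendsto_zero_of_firstShell {g : (UnitAddTorus (Fin 2)) → (EuclideanSpace ℝ (Fin 2))}
    (hg : IsSmooth g) (hgm : HasZeroMean g)
    (hg1 : ∀ k : (Fin 2 → ℤ), freqNormSq k ≠ 1 → mFourierCoeff (EuclideanSpace.complexify ∘ g) k = 0)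
    {ν : ℝ} (hν : 0 < ν) {u₀ : (UnitAddTorus (Fin 2)) → (EuclideanSpace ℝ (Fin 2))} (hu₀ : MemLp u₀ 2 volume)
    (hdiv : IsWeaklyDivFree u₀) (hmean : HasZeroMean u₀) :
    ∃ u : ℝ → (UnitAddTorus (Fin 2)) → (EuclideanSpace ℝ (Fin 2)), IsGlobalLerayHopf ν (fun _ => g) u₀ u ∧
      (∃ K : ℝ, ∀ t, 0 ≤ t → ∫ x, ‖u t x‖ ^ 2 ≤ K) ∧
      Tendsto (fun t => enstrophyExcess (u t)) atTop (𝓝 0) := by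
  classical
  -- the force and its coefficients
  set f : (UnitAddTorus (Fin 2)) → (EuclideanSpace ℝ (Fin 2)) := g with hf_def
  have hf_smooth : IsSmooth f := hg
  have hf_int : Integrable f volume := hf_smooth.integrable
  have hfm : AEStronglyMeasurable (stLift fun _ : ℝ => f) (volume.restrict (Ioi 0 ×ˢ univ)) :=
    aestronglyMeasurable_stLift_steady hf_smooth.continuous _
  have hf₂ : ∀ T : ℝ, 0 < T → ∫⁻ _ in Ioo 0 T, ∫⁻ x, ‖f x‖ₑ ^ 2 < ⊤ := fun T _ =>
    lintegral_Ioo_lintegral_enorm_sq_steady_lt_top (hf_smooth.memLp 2) T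
  set fhat : (Fin 2 → ℤ) → (EuclideanSpace ℂ (Fin 2)) := fun k => mFourierCoeff (EuclideanSpace.complexify ∘ f) k with hfhat
  set uhat₀ : (Fin 2 → ℤ) → (EuclideanSpace ℂ (Fin 2)) := fun k => mFourierCoeff (EuclideanSpace.complexify ∘ u₀) k with huhat₀
  have hu₀_int : Integrable u₀ volume := hu₀.integrable one_le_two
  -- the frequency sets `S n = freqBall (n + 1)`
  set S : ℕ → Finset (Fin 2 → ℤ) := fun n => freqBall (n + 1) with hS_def
  have hS : ∀ n, ∀ k ∈ S n, -k ∈ S n := fun n => neg_mem_freqBall_of_mem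
  have h0S : ∀ n, (0 : (Fin 2 → ℤ)) ∈ S n := fun n => zero_mem_freqBall _
  -- force and data coefficient vectors
  set gc : (n : ℕ) → ↥(S n) → (EuclideanSpace ℂ (Fin 2)) := fun n k => fhat k with hgc
  set c₀ : (n : ℕ) → ↥(S n) → (EuclideanSpace ℂ (Fin 2)) := fun n k => uhat₀ k with hc₀
  have hg_real : ∀ n, IsRealCoeff (gc n) := fun n => isRealCoeff_mFourierCoeff hf_int
  have hc₀_mem : ∀ n, c₀ n ∈ galerkinSubspace (S n) := fun n =>
    ⟨isRealCoeff_mFourierCoeff hu₀_int, isSolenoidalCoeff_restrict (hdiv.isTransversal_mFourierCoeff hu₀ (S n))⟩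
  have hg0 : ∀ n, gc n ⟨0, h0S n⟩ = 0 := fun n => by
    show fhat 0 = 0
    exact mFourierCoeff_zero_of_hasZeroMean hf_int hgm
  have hg1' : ∀ n (k : ↥(S n)), freqNormSq (k : (Fin 2 → ℤ)) ≠ 1 → gc n k = 0 := fun n k hk =>
    hg1 k hk
  have hc₀0 : ∀ n, c₀ n ⟨0, h0S n⟩ = 0 := fun n => by
    show uhat₀ 0 = 0
    exact mFourierCoeff_zero_of_hasZeroMean hu₀_int hmean
  -- the global Galerkin solutions
  have hsol : ∀ n : ℕ, ∃ β : ℝ → ↥(S n) → (EuclideanSpace ℂ (Fin 2)), β 0 = c₀ n ∧ (∀ t, β t ∈ galerkinSubspace (S n)) ∧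
      ContinuousOn β (Ici 0) ∧
      ∀ T, ∀ t ∈ Icc 0 T, HasDerivWithinAt β (galerkinRHS (S n) ν (gc n) (β t)) (Icc 0 T) t :=
    fun n => exists_galerkin_solution ν hν.le (hS n) (g := fun _ => gc n) continuous_const
      (fun _ => hg_real n) (hc₀_mem n)
  choose β hβ0 hβmem hβcont hβderiv using hsol
  -- the fields
  set F : ℕ → ℝ → (UnitAddTorus (Fin 2)) → (EuclideanSpace ℝ (Fin 2)) := fun n _ => realTrigPoly (S n) (coeffExt (S n) (gc n)) with hF
  set U : ℕ → ℝ → (UnitAddTorus (Fin 2)) → (EuclideanSpace ℝ (Fin 2)) := fun n t => realTrigPoly (S n) (coeffExt (S n) (β n t)) with hU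
  have hFf : ∀ n t, F n t = f := by
    intro n t
    show realTrigPoly (S n) (coeffExt (S n) fun k : ↥(S n) => fhat k) = f
    rw [realTrigPoly_coeffExt_restrict, hfhat, ← fourierTruncate_eq]
    refine fourierTruncate_eq_self hf_smooth.continuous fun k hk => hg1 k ?_
    have h1 : (1 : ℝ) ≤ ((n + 1 : ℕ) : ℝ) ^ 2 := by
      have : (1 : ℝ) ≤ ((n + 1 : ℕ) : ℝ) := by exact_mod_cast Nat.le_add_left 1 n
      nlinarith
    exact ne_of_gt (h1.trans_lt hk)
  have hU0 : ∀ n, U n 0 = fourierTruncate (n + 1) u₀ := by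
    intro n
    show realTrigPoly (S n) (coeffExt (S n) (β n 0)) = _
    rw [hβ0 n, fourierTruncate_eq]
    exact realTrigPoly_coeffExt_restrict _
  have hband : ∀ {n : ℕ} {b : (UnitAddTorus (Fin 2)) → (EuclideanSpace ℝ (Fin 2))}, IsGalerkinMode (n + 1) b →
      ∀ k ∉ S n, mFourierCoeff (EuclideanSpace.complexify ∘ b) k = 0 :=
    fun hb k hk => hb.mFourierCoeff_eq_zero (not_mem_freqBall.1 hk)
  -- the scheme
  have hScheme : IsHopfGalerkinScheme ν (fun _ => f) u₀ (fun n => n + 1) F U :=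
    { tendsto_order := tendsto_add_atTop_nat 1
      smooth_force := fun n => contDiff_stLift_realTrigPoly (g := fun _ : ℝ => gc n) contDiff_const
      tendsto_force := fun T _ => by
        have h0 : (fun n => ∫⁻ t in Ioo 0 T, ∫⁻ x, ‖F n t x - f x‖ₑ ^ 2) = fun _ => 0 := by
          funext n
          simp only [hFf, sub_self, enorm_zero, ne_eq, OfNat.ofNat_ne_zero, not_false_eq_true,
            zero_pow, lintegral_zero]
        rw [h0]
        exact tendsto_const_nhds
      continuousOn := fun n => continuousOn_stLift_realTrigPoly (hβcont n)
      isGalerkinMode := fun n t _ =>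
        have h := galerkin_slice_props (hS n) (hβmem n t)
        ⟨h.1, h.2.1, fun k hk => h.2.2.2 k (not_mem_freqBall.2 hk)⟩
      isWeaklyDivFree := fun n t _ => (galerkin_slice_props (hS n) (hβmem n t)).2.2.1
      galerkin := fun n b hb s t hs hst =>
        galerkin_test_identity ν (hS n) (g := fun _ => gc n) continuous_const (fun _ => hg_real n)
          (hβmem n) (hβderiv n) hb.isSmooth hb.isDivFree (hband hb) hs hst
      energy_eq := fun n s t hs hst =>
        galerkin_energy_identity ν (hS n) (g := fun _ => gc n) continuous_const (fun _ => hg_real n)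
          (hβmem n) (hβderiv n) hs hst
      initial_inner := fun n b hb => by
        rw [hU0 n]
        exact integral_inner_fourierTruncate_eq hu₀ (hb.isSmooth.memLp 2) (hband hb)
      tendsto_initial := by
        have heq : (fun n => eLpNorm (U n 0 - u₀) 2 volume) =
            fun n => eLpNorm (fourierTruncate (n + 1) u₀ - u₀) 2 volume := by
          funext n; rw [hU0 n]
        rw [heq]
        exact (tendsto_eLpNorm_fourierTruncate_sub hu₀).comp (tendsto_add_atTop_nat 1) }
  -- the limit field and the global Leray–Hopf solution
  obtain ⟨φ, hφ, u, hum, hu, hc⟩ := hScheme.exists_limitField hν.le hu₀ hfm hf₂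
  have hLH : IsGlobalLerayHopf ν (fun _ => f) u₀ u := fun T hT =>
    (hScheme.comp_strictMono hφ).isLerayHopfOn_limit hν hu₀ hdiv hfm hf₂ hum hu hc hT
  -- uniform bounds at the Galerkin level
  set E0 : ℝ := ∫ x, ‖u₀ x‖ ^ 2 with hE0
  set Ef : ℝ := ∫ x, ‖f x‖ ^ 2 with hEf
  set K : ℝ := E0 + Ef / (16 * Real.pi ^ 4 * ν ^ 2) with hK
  set C : ℝ := (2 * ν)⁻¹ * (2 * E0 + Ef + Ef / (16 * Real.pi ^ 4 * ν ^ 2)) with hC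
  have hψ0 : ∀ n, ∑ k, ‖β n 0 k‖ ^ 2 ≤ E0 := by
    intro n
    rw [hβ0 n]
    show ∑ k : ↥(S n), ‖uhat₀ k‖ ^ 2 ≤ E0
    rw [Finset.sum_coe_sort (S n) (fun k => ‖uhat₀ k‖ ^ 2)]
    exact sum_sq_norm_mFourierCoeff_le_integral hu₀ (S n)
  have hGf : ∀ n, ∑ k, ‖gc n k‖ ^ 2 ≤ Ef := by
    intro n
    show ∑ k : ↥(S n), ‖fhat k‖ ^ 2 ≤ Ef
    rw [Finset.sum_coe_sort (S n) (fun k => ‖fhat k‖ ^ 2)]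
    exact sum_sq_norm_mFourierCoeff_le_integral (hf_smooth.memLp 2) (S n)
  have hνsq : 0 < 16 * Real.pi ^ 4 * ν ^ 2 := by positivity
  have hbound_n : ∀ n t, 0 ≤ t → ∑ k, ‖β n t k‖ ^ 2 ≤ K := by
    intro n t ht
    refine (galerkin_sum_norm_sq_le hν (hS n) (hg_real n) (hβmem n) (hβderiv n) (h0S n) (hg0 n)
      (by rw [hβ0 n]; exact hc₀0 n) ht).trans ?_
    have h1 := hψ0 n
    have h2 := hGf n
    rw [hK]
    gcongr
  have hexcess_n : ∀ n t, 1 ≤ t → ∑ k : ↥(S n), excessWeight (k : (Fin 2 → ℤ)) * ‖β n t k‖ ^ 2 ≤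
      C * Real.exp (-(16 * Real.pi ^ 2 * ν) * (t - 1)) := by
    intro n t ht
    have h1 := galerkin_excess_le_mul_exp hν.le (hS n) (hβmem n) (hβderiv n) (hg1' n)
      zero_le_one ht
    have h2 := galerkin_excess_one_le hν (hS n) (hg_real n) (hβmem n) (hβderiv n) (h0S n) (hg0 n)
      (by rw [hβ0 n]; exact hc₀0 n) (hg1' n)
    have h3 : (2 * ν)⁻¹ * (2 * (∑ k, ‖β n 0 k‖ ^ 2) + (∑ k, ‖gc n k‖ ^ 2) +
        (∑ k, ‖gc n k‖ ^ 2) / (16 * Real.pi ^ 4 * ν ^ 2)) ≤ C := by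
      have ha := hψ0 n
      have hb := hGf n
      rw [hC]
      gcongr
    exact h1.trans (mul_le_mul_of_nonneg_right (h2.trans h3) (Real.exp_pos _).le)
  -- Fourier coefficients of the Galerkin states
  have hcoefU : ∀ n t k, mFourierCoeff (EuclideanSpace.complexify ∘ U n t) k = coeffExt (S n) (β n t) k :=
    fun n t k => mFourierCoeff_realTrigPoly_coeffExt (hS n) (hβmem n t).1 k
  -- passage to the limit, 1: the uniform `L²` bound
  have hB1 : ∀ t, 0 ≤ t → ∫ x, ‖u t x‖ ^ 2 ≤ K := by
    intro t ht
    have hsum : HasSum (fun k : (Fin 2 → ℤ) => ‖mFourierCoeff (EuclideanSpace.complexify ∘ u t) k‖ ^ 2)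
        (∫ x, ‖u t x‖ ^ 2) := hasSum_sq_norm_mFourierCoeff_complexify (hu t ht)
    rw [← hsum.tsum_eq]
    refine hsum.summable.tsum_le_of_sum_le fun S' => ?_
    have hlim : Tendsto (fun j => ∑ k ∈ S', ‖mFourierCoeff (EuclideanSpace.complexify ∘ U (φ j) t) k‖ ^ 2)
        atTop (𝓝 (∑ k ∈ S', ‖mFourierCoeff (EuclideanSpace.complexify ∘ u t) k‖ ^ 2)) :=
      tendsto_finsetSum _ fun k _ => ((hc t ht k).norm).pow 2
    refine le_of_tendsto' hlim fun j => ?_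
    calc ∑ k ∈ S', ‖mFourierCoeff (EuclideanSpace.complexify ∘ U (φ j) t) k‖ ^ 2
        ≤ ∑ k ∈ S (φ j), ‖coeffExt (S (φ j)) (β (φ j) t) k‖ ^ 2 := by
          simp_rw [hcoefU]
          exact sum_le_sum_of_support_subset (fun k => sq_nonneg _)
            (fun k hk => by rw [coeffExt_of_not_mem _ hk, norm_zero, zero_pow two_ne_zero])
      _ = ∑ k, ‖β (φ j) t k‖ ^ 2 := sum_coeffExt (fun _ v => ‖v‖ ^ 2) _
      _ ≤ K := hbound_n (φ j) t ht
  -- passage to the limit, 2: the enstrophy excess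
  have hB2 : ∀ t, 1 ≤ t → enstrophyExcess (u t) ≤
      ENNReal.ofReal (C * Real.exp (-(16 * Real.pi ^ 2 * ν) * (t - 1))) := by
    intro t ht
    have ht0 : 0 ≤ t := zero_le_one.trans ht
    rw [enstrophyExcess_eq_tsum_ofReal, ENNReal.tsum_eq_iSup_sum]
    refine iSup_le fun S' => ?_
    have hlim : Tendsto (fun j => ∑ k ∈ S', ENNReal.ofReal (excessWeight k *
        ‖mFourierCoeff (EuclideanSpace.complexify ∘ U (φ j) t) k‖ ^ 2)) atTop
        (𝓝 (∑ k ∈ S', ENNReal.ofReal (excessWeight k *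
          ‖mFourierCoeff (EuclideanSpace.complexify ∘ u t) k‖ ^ 2))) :=
      tendsto_finsetSum _ fun k _ =>
        ENNReal.tendsto_ofReal ((((hc t ht0 k).norm).pow 2).const_mul _)
    refine le_of_tendsto' hlim fun j => ?_
    rw [← ENNReal.ofReal_sum_of_nonneg fun k _ => mul_nonneg (excessWeight_nonneg k) (sq_nonneg _)]
    refine ENNReal.ofReal_le_ofReal ?_
    calc ∑ k ∈ S', excessWeight k * ‖mFourierCoeff (EuclideanSpace.complexify ∘ U (φ j) t) k‖ ^ 2
        ≤ ∑ k ∈ S (φ j), excessWeight k * ‖coeffExt (S (φ j)) (β (φ j) t) k‖ ^ 2 := by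
          simp_rw [hcoefU]
          exact sum_le_sum_of_support_subset (fun k => mul_nonneg (excessWeight_nonneg k) (sq_nonneg _))
            (fun k hk => by rw [coeffExt_of_not_mem _ hk, norm_zero, zero_pow two_ne_zero, mul_zero])
      _ = ∑ k : ↥(S (φ j)), excessWeight (k : (Fin 2 → ℤ)) * ‖β (φ j) t k‖ ^ 2 := sum_coeffExt (fun k v => excessWeight k * ‖v‖ ^ 2) _
      _ ≤ C * Real.exp (-(16 * Real.pi ^ 2 * ν) * (t - 1)) := hexcess_n (φ j) t ht
  -- conclusion
  refine ⟨u, hLH, ⟨K, hB1⟩, ?_⟩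
  have hdecay : Tendsto (fun t => ENNReal.ofReal (C * Real.exp (-(16 * Real.pi ^ 2 * ν) * (t - 1))))
      atTop (𝓝 0) := by
    rw [← ENNReal.ofReal_zero]
    refine ENNReal.tendsto_ofReal ?_
    have h1 : Tendsto (fun t : ℝ => -(16 * Real.pi ^ 2 * ν) * (t - 1)) atTop atBot := by
      have hc : -(16 * Real.pi ^ 2 * ν) < 0 := by
        have : 0 < 16 * Real.pi ^ 2 * ν := by positivity
        linarith
      exact (tendsto_atTop_add_const_right _ (-1) tendsto_id).const_mul_atTop_of_neg hc
    have h2 := Real.tendsto_exp_atBot.comp h1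
    simpa using h2.const_mul C
  refine tendsto_of_tendsto_of_tendsto_of_le_of_le' tendsto_const_nhds hdecay
    (Eventually.of_forall fun t => bot_le) ?_
  filter_upwards [eventually_ge_atTop 1] with t ht
  exact hB2 t ht

end GalerkinHalf

end Summit.AnomalousDissipation.AnomalousDissipation.Theorems.TwodBoundedEnergyZeroMomentum.Negative

end
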